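import Summits.ResolutionOfSingularities.ResolutionOfSingularities.Theorems.PurelyInseparableDim4PureLeafKCentres
import Summits.ResolutionOfSingularities.ResolutionOfSingularities.Theorems.PurelyInseparableDim4PureLeafFpGlobalWin
import HarnessLib
import HarnessLib.Audit.Tags

/-!
# Purely inseparable fourfolds — EVERY PURE LEAF WINS THE PLAIN GLOBAL GAME over EVERY FIELD of characteristic `p`,
# and MODE 1h TERMINATES from it (cell res-dim4-pi; D3d: the `∀K ∧ ∀p` form of D3c)
# [OURS · counted 0 · a theorem about OUR coordinate-centre frame v4, not about resolution]

Width seat `res-dim4-p-10` (g3).  For every field `K` of characteristic `p` (`[Field K] [CharP K p] [DecidableEq K]`), every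
`a : Fin 4 → ℕ` with some `p ∤ aᵢ`, every booking: **`stateWins_monomial_charP`** — `StateWins p ⟨x^a, r, exc⟩` over `K` (A beats
every sequence of `K`-rational replies in the tree's `Edge`, along-centre moves included) and **`no_step1h_chain_monomial_charP`** —
no infinite `Step1h p` chain from `⟨x^a, r, exc⟩` (every tie-break, every `K`-rational reply).  The class is that of D3c with a
finite ROOT SET `R ⊂ K` carried along (kits E_K–H_K): `T(R,k)·(N(R,μ) − C γ(R,μ))`, supports in `R`, (G1) `μ < p`, (G2) one active
root per variable, (G3) the `p`-th-power part of an active variable has the same root, (G4) some variable active; every MODE-1h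
edge is a root shift of `(k − δ_{(j,0)}, μ)` or `(k, μ[(j,0) ↦ Σ_S μ − p])` onto `R′ = ⋃ᵢ (R + bᵢ)` with `W = Σᵢ Σ_{c∈R} (p·k + μ)`
smaller (`edge_generalForm`), strong induction (`classWins`).  Riders: `K`-rational replies for the given `K` (every `K` separately);
every tie-break; NOT F4-C; all-`p`-divisible leaves excluded by hypothesis.  Nothing here proves `Terminates1h`, F4-C or resolution of
singularities in dimension ≥ 4 / characteristic `p`; counted 0; AI work, weaker than expert review. bears_on: LADDER-RESOLUTION:D157-DOOR2
(res-dim4-pi · D3d). Supports stmt-ResolutionOfSingularities-16155 (helper).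
-/

set_option linter.dupNamespace false

open MvPolynomial Finset

open scoped BigOperators

noncomputable section
namespace Summit.ResolutionOfSingularities.ResolutionOfSingularities.Theorems.PIDim4

namespace PureLeafK

open Literature.AlgebraicGeometry.Resolution
open Literature.AlgebraicGeometry.Resolution.Hauser2010
open CentreBlowup PthPowerFactor PureLeafNF

variable {K : Type} [Field K] [DecidableEq K] (p : ℕ) [Fact p.Prime] [CharP K p]

/-! ## 1. Invariants under the moves -/

omit [DecidableEq K] [Fact p.Prime] [CharP K p] in
/-- (G3) is kept by root shifts. [folklore] -/
theorem sameRoot_shift {k μ : Fin 4 → K → ℕ} (h3 : ∀ i c, μ i c ≠ 0 → ∀ c', c' ≠ c → k i c' = 0) (b : Fin 4 → K) :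
    ∀ i c, μ i (c - b i) ≠ 0 → ∀ c', c' ≠ c → k i (c' - b i) = 0 :=
  fun i c hc c' hc' => h3 i (c - b i) hc (c' - b i) (fun h => hc' (sub_left_injective h))

omit [DecidableEq K] [Fact p.Prime] [CharP K p] in
/-- (G4) is kept by root shifts. [folklore] -/
theorem active_shift {μ : Fin 4 → K → ℕ} (h4 : ∃ i c, μ i c ≠ 0) (b : Fin 4 → K) : ∃ i c, μ i (c - b i) ≠ 0 := by
  obtain ⟨i, c, hc⟩ := h4
  exact ⟨i, c + b i, by rwa [add_sub_cancel_right]⟩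

omit [Fact p.Prime] [CharP K p] in
/-- (G3) is kept by the singleton chart followed by a root shift. [folklore] -/
theorem sameRoot_singleton_chart {k μ : Fin 4 → K → ℕ} (h3 : ∀ i c, μ i c ≠ 0 → ∀ c', c' ≠ c → k i c' = 0) (j : Fin 4)
    (b : Fin 4 → K) :
    ∀ i c, μ i (c - b i) ≠ 0 → ∀ c', c' ≠ c → (if i = j ∧ c' - b i = 0 then k j 0 - 1 else k i (c' - b i)) = 0 :=
  fun i c hc c' hc' => by
  have h := sameRoot_shift h3 b i c hc c' hc'
  split_ifs with hij
  · obtain ⟨rfl, h0⟩ := hij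
    rw [h0] at h
    omega
  · exact h

omit [Fact p.Prime] [CharP K p] in
/-- The support condition of the chart-shifted `p`-th-power array. [folklore] -/
theorem support_singleton_chart_shift (R : Finset K) {k : Fin 4 → K → ℕ} (hSk : ∀ i c, c ∉ R → k i c = 0) (j : Fin 4)
    (b : Fin 4 → K) :
    ∀ i c, c ∉ Finset.univ.biUnion (fun i => R.map (addRightEmbedding (b i))) →
      (if i = j ∧ c - b i = 0 then k j 0 - 1 else k i (c - b i)) = 0 := fun i c hc => by
  have h := support_shift R k hSk b i c hc
  split_ifs with hij
  · obtain ⟨rfl, h0⟩ := hij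
    rw [h0] at h; rw [h]
  · exact h

/-! ## 2. MODE-1h centres at a class state -/

/-- **A permissible singleton is `{x_j}` with `1 ≤ k j 0`** (both regimes; cleaned constant). [folklore] -/
theorem one_le_of_isPermissibleCentre_singleton (R : Finset K) (k μ : Fin 4 → K → ℕ) (hSk : ∀ i c, c ∉ R → k i c = 0)
    (hSμ : ∀ i c, c ∉ R → μ i c = 0) (hμ : ∀ i c, μ i c < p) (h1 : ∀ i c, μ i c ≠ 0 → ∀ c', c' ≠ c → μ i c' = 0)
    (h4 : ∃ i c, μ i c ≠ 0) {j : Fin 4}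
    (hS : IsPermissibleCentre p {j} ((∏ i, ∏ c ∈ R, (X i + C c) ^ (p * k i c) : MvPolynomial (Fin 4) K) *
      ((∏ i, ∏ c ∈ R, (X i + C c) ^ μ i c) - C (∏ i, ∏ c ∈ R, c ^ μ i c)))) :
    1 ≤ k j 0 := by
  by_contra hlt
  have hj0 : k j 0 = 0 := by omega
  obtain ⟨-, hord⟩ := hS
  by_cases hγ : (∏ i, ∏ c ∈ R, c ^ μ i c) = 0
  · rw [hγ, ordAlong_generalForm_C_zero p R k μ hSk hSμ, Finset.sum_singleton, hj0, mul_zero, zero_add] at hord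
    have : p ≤ μ j 0 := by exact_mod_cast hord
    exact absurd (hμ j 0) (not_lt.mpr this)
  · have hact : ∀ i c, μ i c ≠ 0 → c ≠ 0 := fun i c hc hc0 =>
      hγ ((gamma_eq_zero_iff R μ hSμ).mpr ⟨i, by rwa [hc0] at hc⟩)
    obtain ⟨i₀, c₀, hi₀⟩ := h4
    have hle := ordAlong_singleton_generalForm_le_one p R k μ hSk hSμ hμ h1 hact hi₀ hj0
    have h2 : (p : ℕ∞) ≤ 1 := le_trans hord hle
    have : p ≤ 1 := by exact_mod_cast h2
    exact absurd (Fact.out : p.Prime).one_lt (not_lt.mpr this)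

/-- **MODE-1h centres, case A**: some `k j 0 ≥ 1` ⇒ the centre is a singleton `{x_{j'}}` with `k j' 0 ≥ 1`. [folklore] -/
theorem isMode1hCentre_generalForm_singleton (R : Finset K) (k μ : Fin 4 → K → ℕ) (hSk : ∀ i c, c ∉ R → k i c = 0)
    (hSμ : ∀ i c, c ∉ R → μ i c = 0) (hμ : ∀ i c, μ i c < p) (h1 : ∀ i c, μ i c ≠ 0 → ∀ c', c' ≠ c → μ i c' = 0)
    (h4 : ∃ i c, μ i c ≠ 0) {j : Fin 4} (hj : 1 ≤ k j 0) {S : Finset (Fin 4)}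
    (hS : IsMode1hCentre p S ((∏ i, ∏ c ∈ R, (X i + C c) ^ (p * k i c) : MvPolynomial (Fin 4) K) *
      ((∏ i, ∏ c ∈ R, (X i + C c) ^ μ i c) - C (∏ i, ∏ c ∈ R, c ^ μ i c)))) :
    ∃ j', S = {j'} ∧ 1 ≤ k j' 0 := by
  obtain ⟨hperm, hmin⟩ := hS
  have hcard := hmin {j} ⟨Finset.singleton_nonempty j, le_ordAlong_singleton_generalForm p R k μ hSk _ hj⟩
  rw [Finset.card_singleton] at hcard
  obtain ⟨j', hj'⟩ := Finset.card_eq_one.mp (le_antisymm hcard (Finset.card_pos.mpr hperm.1))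
  refine ⟨j', hj', ?_⟩
  rw [hj'] at hperm
  exact one_le_of_isPermissibleCentre_singleton p R k μ hSk hSμ hμ h1 h4 hperm

/-- **MODE-1h centres, case B**: every `k j 0 = 0` ⇒ product regime and a minimal block of pure variables. [folklore] -/
theorem isMode1hCentre_generalForm_block (R : Finset K) (k μ : Fin 4 → K → ℕ) (hSk : ∀ i c, c ∉ R → k i c = 0)
    (hSμ : ∀ i c, c ∉ R → μ i c = 0) (hμ : ∀ i c, μ i c < p) (h1 : ∀ i c, μ i c ≠ 0 → ∀ c', c' ≠ c → μ i c' = 0)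
    (h4 : ∃ i c, μ i c ≠ 0) (hn0 : ∀ j, k j 0 = 0) {S : Finset (Fin 4)}
    (hS : IsMode1hCentre p S ((∏ i, ∏ c ∈ R, (X i + C c) ^ (p * k i c) : MvPolynomial (Fin 4) K) *
      ((∏ i, ∏ c ∈ R, (X i + C c) ^ μ i c) - C (∏ i, ∏ c ∈ R, c ^ μ i c)))) :
    (∏ i, ∏ c ∈ R, c ^ μ i c) = 0 ∧ (∀ i ∈ S, μ i 0 ≠ 0) ∧ p ≤ (∑ i ∈ S, μ i 0) ∧
      (∀ j ∈ S, (∑ i ∈ S.erase j, μ i 0) < p) ∧ 2 ≤ S.card := by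
  obtain ⟨hperm, hmin⟩ := hS
  by_cases hγ : (∏ i, ∏ c ∈ R, c ^ μ i c) = 0
  · have hordS : ∀ T : Finset (Fin 4), ordAlong T ((∏ i, ∏ c ∈ R, (X i + C c) ^ (p * k i c) : MvPolynomial (Fin 4) K) *
        ((∏ i, ∏ c ∈ R, (X i + C c) ^ μ i c) - C (∏ i, ∏ c ∈ R, c ^ μ i c))) = ((∑ i ∈ T, μ i 0 : ℕ) : ℕ∞) := fun T => by
      rw [hγ, ordAlong_generalForm_C_zero p R k μ hSk hSμ]
      congr 1
      exact_mod_cast Finset.sum_congr rfl fun i _ => by rw [hn0 i, mul_zero, zero_add]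
    have hpS : p ≤ ∑ i ∈ S, μ i 0 := by
      have h := hperm.2; rw [hordS] at h; exact_mod_cast h
    have herase : ∀ j ∈ S, (∑ i ∈ S.erase j, μ i 0) < p := fun j hj => by
      by_contra hge
      rw [not_lt] at hge
      have hne : (S.erase j).Nonempty := by
        by_contra he
        rw [Finset.not_nonempty_iff_eq_empty] at he
        rw [he, Finset.sum_empty] at hge
        exact absurd hge (not_le.mpr (Fact.out : p.Prime).pos)
      have hpermE : IsPermissibleCentre p (S.erase j) ((∏ i, ∏ c ∈ R, (X i + C c) ^ (p * k i c) : MvPolynomial (Fin 4) K) *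
          ((∏ i, ∏ c ∈ R, (X i + C c) ^ μ i c) - C (∏ i, ∏ c ∈ R, c ^ μ i c))) :=
        ⟨hne, by rw [hordS]; exact_mod_cast hge⟩
      have := hmin _ hpermE
      rw [Finset.card_erase_of_mem hj] at this
      have hpos := Finset.card_pos.mpr hperm.1
      omega
    have hact : ∀ i ∈ S, μ i 0 ≠ 0 := fun i hi h0 => by
      have h := herase i hi
      have hS' : μ i 0 + ∑ t ∈ S.erase i, μ t 0 = ∑ t ∈ S, μ t 0 := Finset.add_sum_erase S (fun i => μ i 0) hi
      omega
    have hcard : 2 ≤ S.card := by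
      by_contra hlt
      have hpos := Finset.card_pos.mpr hperm.1
      have hc1 : S.card = 1 := by omega
      obtain ⟨j, hj⟩ := Finset.card_eq_one.mp hc1
      rw [hj, Finset.sum_singleton] at hpS
      exact absurd (hμ j 0) (not_lt.mpr hpS)
    exact ⟨hγ, hact, hpS, herase, hcard⟩
  · exfalso
    have hact : ∀ i c, μ i c ≠ 0 → c ≠ 0 := fun i c hc hc0 =>
      hγ ((gamma_eq_zero_iff R μ hSμ).mpr ⟨i, by rwa [hc0] at hc⟩)
    obtain ⟨i₀, c₀, hi₀⟩ := h4
    have hle := ordAlong_generalForm_le_one p R k μ (∏ i, ∏ c ∈ R, c ^ μ i c) hSμ hμ h1 hact hn0 hi₀ S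
    have h2 : (p : ℕ∞) ≤ 1 := le_trans hperm.2 hle
    have : p ≤ 1 := by exact_mod_cast h2
    exact absurd (Fact.out : p.Prime).one_lt (not_lt.mpr this)

/-! ## 3. The edge lemma and the induction -/

/-- **THE EDGE LEMMA over `K`.** From a class state every edge of every MODE-1h centre leads to a class state (on the root set
`R′ = ⋃ᵢ (R + bᵢ)`) of strictly smaller measure. [OURS · counted 0] [folklore] -/
theorem edge_generalForm (s s' : State K) (R : Finset K) (k μ : Fin 4 → K → ℕ)
    (hF : s.F = (∏ i, ∏ c ∈ R, (X i + C c) ^ (p * k i c) : MvPolynomial (Fin 4) K) *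
      ((∏ i, ∏ c ∈ R, (X i + C c) ^ μ i c) - C (∏ i, ∏ c ∈ R, c ^ μ i c)))
    (hSk : ∀ i c, c ∉ R → k i c = 0) (hSμ : ∀ i c, c ∉ R → μ i c = 0)
    (hμ : ∀ i c, μ i c < p) (h1 : ∀ i c, μ i c ≠ 0 → ∀ c', c' ≠ c → μ i c' = 0)
    (h3 : ∀ i c, μ i c ≠ 0 → ∀ c', c' ≠ c → k i c' = 0) (h4 : ∃ i c, μ i c ≠ 0)
    {S : Finset (Fin 4)} (hS : IsMode1hCentre p S s.F) (hE : Edge p S s s') :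
    ∃ (R' : Finset K) (k' μ' : Fin 4 → K → ℕ),
      s'.F = (∏ i, ∏ c ∈ R', (X i + C c) ^ (p * k' i c) : MvPolynomial (Fin 4) K) *
        ((∏ i, ∏ c ∈ R', (X i + C c) ^ μ' i c) - C (∏ i, ∏ c ∈ R', c ^ μ' i c)) ∧
      (∀ i c, c ∉ R' → k' i c = 0) ∧ (∀ i c, c ∉ R' → μ' i c = 0) ∧
      (∀ i c, μ' i c < p) ∧ (∀ i c, μ' i c ≠ 0 → ∀ c', c' ≠ c → μ' i c' = 0) ∧
      (∀ i c, μ' i c ≠ 0 → ∀ c', c' ≠ c → k' i c' = 0) ∧ (∃ i c, μ' i c ≠ 0) ∧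
      ∑ i, ∑ c ∈ R', (p * k' i c + μ' i c) < ∑ i, ∑ c ∈ R, (p * k i c + μ i c) := by
  obtain ⟨j, b, hjS, hbj, heq, hne, rfl⟩ := hE
  rw [hF] at hS
  have hp : 0 < p := (Fact.out : p.Prime).pos
  by_cases hA : ∃ j₀, 1 ≤ k j₀ 0
  · obtain ⟨j₀, hj₀⟩ := hA
    obtain ⟨j', rfl, hj'⟩ := isMode1hCentre_generalForm_singleton p R k μ hSk hSμ hμ h1 h4 hj₀ hS
    rw [Finset.mem_singleton] at hjS
    subst hjS
    have h0 : (0 : K) ∈ R := Classical.by_contradiction fun h => by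
      have h00 : k j 0 = 0 := hSk j 0 h
      omega
    refine ⟨_, _, _, step_singleton_generalForm p s R k μ (∏ i, ∏ c ∈ R, c ^ μ i c) hF hSk hSμ hμ h1 hj' b,
      support_singleton_chart_shift R hSk j b, support_shift R μ hSμ b, small_shift hμ b, singleRoot_shift h1 b,
      sameRoot_singleton_chart h3 j b, active_shift h4 b, ?_⟩
    have hw := weight_singleton_chart p R k μ h0 hj'
    have hSk' : ∀ i c, c ∉ R → (if i = j ∧ c = 0 then k j 0 - 1 else k i c) = 0 := fun i c hc => by
      rw [if_neg (fun h : i = j ∧ c = 0 => hc (by rw [h.2]; exact h0))]; exact hSk i c hc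
    have hsh := weight_shift p R (fun i c => if i = j ∧ c = 0 then k j 0 - 1 else k i c) μ hSk' hSμ b
    exact lt_of_eq_of_lt hsh (by omega)
  · push Not at hA
    have hn0 : ∀ j, k j 0 = 0 := fun j => by have := hA j; omega
    obtain ⟨hγ, hact, hpS, herase, hcard⟩ := isMode1hCentre_generalForm_block p R k μ hSk hSμ hμ h1 h4 hn0 hS
    have hF0 : s.F = (∏ i, ∏ c ∈ R, (X i + C c) ^ (p * k i c) : MvPolynomial (Fin 4) K) *
        ((∏ i, ∏ c ∈ R, (X i + C c) ^ μ i c) - C 0) := by rw [hF, hγ]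
    have hnS : ∀ i ∈ S, ∀ c, k i c = 0 := fun i hi c => by
      by_cases hc : c = 0
      · rw [hc]; exact hn0 i
      · exact h3 i 0 (hact i hi) c hc
    have hμS : ∀ i ∈ S, ∀ c, c ≠ 0 → μ i c = 0 := fun i hi c hc => h1 i 0 (hact i hi) c hc
    have h0 : (0 : K) ∈ R := by by_contra h; exact hact j hjS (hSμ j 0 h)
    have hlt : (∑ i ∈ S, μ i 0) - p < p := by
      have h := herase j hjS
      have hS' : μ j 0 + ∑ i ∈ S.erase j, μ i 0 = ∑ i ∈ S, μ i 0 := Finset.add_sum_erase S (fun i => μ i 0) hjS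
      have := hμ j 0
      omega
    have hSμ' : ∀ i c, c ∉ R → (if i = j ∧ c = 0 then (∑ i ∈ S, μ i 0) - p else μ i c) = 0 := fun i c hc => by
      rw [if_neg (fun h : i = j ∧ c = 0 => hc (by rw [h.2]; exact h0))]; exact hSμ i c hc
    refine ⟨_, _, _, step_block_generalForm p s R k μ hF0 hSk hSμ hμ h1 S hjS hnS hμS (hact j hjS) hlt b,
      support_shift R k hSk b, support_shift R _ hSμ' b, ?_, ?_, ?_, ?_, ?_⟩
    · intro i c
      split_ifs
      · exact hlt
      · exact hμ i _
    · intro i c hc c' hc'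
      by_cases hij : i = j
      · subst hij
        by_cases hc0 : c - b i = 0
        · rw [if_neg (fun h => hc' (sub_left_injective (h.2.trans hc0.symm)))]
          exact hμS i hjS _ (fun h => hc' (sub_left_injective (h.trans hc0.symm)))
        · rw [if_neg (fun h => hc0 h.2)] at hc
          exact absurd (hμS i hjS _ hc0) hc
      · rw [if_neg (fun h => hij h.1)] at hc ⊢
        exact singleRoot_shift h1 b i c hc c' hc'
    · intro i c hc c' hc'
      by_cases hij : i = j
      · subst hij
        exact hnS i hjS _
      · rw [if_neg (fun h => hij h.1)] at hc
        exact sameRoot_shift h3 b i c hc c' hc'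
    · obtain ⟨t, ht, htj⟩ : ∃ t ∈ S, t ≠ j := by
        by_contra hno
        push Not at hno
        have hsub : S ⊆ {j} := fun x hx => Finset.mem_singleton.mpr (hno x hx)
        have := Finset.card_le_card hsub
        rw [Finset.card_singleton] at this
        omega
      refine ⟨t, b t, ?_⟩
      rw [if_neg (fun h => htj h.1), sub_self]
      exact hact t ht
    · have hw := weight_block_chart_lt p R k μ h0 S hjS hpS (herase j hjS)
      have hsh := weight_shift p R k (fun i c => if i = j ∧ c = 0 then (∑ i ∈ S, μ i 0) - p else μ i c) hSk hSμ' b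
      exact lt_of_eq_of_lt hsh hw

/-- **THE PURE-LEAF CLASS OVER `K` IS WINNING AND TERMINATING.** [OURS · counted 0] [folklore] -/
theorem classWins : ∀ (W : ℕ) (R : Finset K) (k μ : Fin 4 → K → ℕ), ∑ i, ∑ c ∈ R, (p * k i c + μ i c) ≤ W →
    (∀ i c, c ∉ R → k i c = 0) → (∀ i c, c ∉ R → μ i c = 0) → (∀ i c, μ i c < p) →
    (∀ i c, μ i c ≠ 0 → ∀ c', c' ≠ c → μ i c' = 0) → (∀ i c, μ i c ≠ 0 → ∀ c', c' ≠ c → k i c' = 0) → (∃ i c, μ i c ≠ 0) →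
    ∀ (r : Fin 4 →₀ ℕ) (exc : Finset (Fin 4)),
      StateWins p (⟨(∏ i, ∏ c ∈ R, (X i + C c) ^ (p * k i c) : MvPolynomial (Fin 4) K) *
          ((∏ i, ∏ c ∈ R, (X i + C c) ^ μ i c) - C (∏ i, ∏ c ∈ R, c ^ μ i c)), r, exc⟩ : State K) ∧
      ¬ ∃ ch : ℕ → State K, ch 0 = (⟨(∏ i, ∏ c ∈ R, (X i + C c) ^ (p * k i c) : MvPolynomial (Fin 4) K) *
          ((∏ i, ∏ c ∈ R, (X i + C c) ^ μ i c) - C (∏ i, ∏ c ∈ R, c ^ μ i c)), r, exc⟩ : State K) ∧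
        ∀ t, Step1h p (ch t) (ch (t + 1)) := by
  intro W
  induction W using Nat.strong_induction_on with
  | _ W IH =>
  intro R k μ hW hSk hSμ hμ h1 h3 h4 r exc
  have hstate : ∀ t : State K, t = ⟨t.F, t.r, t.exc⟩ := fun t => rfl
  constructor
  · unfold StateWins
    by_cases hex : ∃ S, IsPermissibleCentre p S ((∏ i, ∏ c ∈ R, (X i + C c) ^ (p * k i c) : MvPolynomial (Fin 4) K) *
        ((∏ i, ∏ c ∈ R, (X i + C c) ^ μ i c) - C (∏ i, ∏ c ∈ R, c ^ μ i c)))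
    · obtain ⟨S, hS⟩ := PureLeafNF.exists_isMode1hCentre_of_exists p _ hex
      refine Game.Wins.move (m := S) hS.1 fun s' hE => ?_
      obtain ⟨R', k', μ', hF', hSk', hSμ', hμ', h1', h3', h4', hlt⟩ :=
        edge_generalForm p _ s' R k μ rfl hSk hSμ hμ h1 h3 h4 hS hE
      rw [hstate s', hF']
      exact ((IH _ (lt_of_lt_of_le hlt hW)) R' k' μ' le_rfl hSk' hSμ' hμ' h1' h3' h4' _ _).1
    · exact Game.Wins.terminal fun S hS => hex ⟨S, hS⟩
  · rintro ⟨ch, h0, hch⟩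
    obtain ⟨S, hS, hE⟩ := hch 0
    rw [h0] at hS hE
    obtain ⟨R', k', μ', hF', hSk', hSμ', hμ', h1', h3', h4', hlt⟩ :=
      edge_generalForm p _ _ R k μ rfl hSk hSμ hμ h1 h3 h4 hS hE
    refine ((IH _ (lt_of_lt_of_le hlt hW)) R' k' μ' le_rfl hSk' hSμ' hμ' h1' h3' h4' (ch 1).r (ch 1).exc).2
      ⟨fun t => ch (t + 1), ?_, fun t => hch (t + 1)⟩
    rw [hstate (ch (0 + 1))]
    show (⟨(ch 1).F, (ch 1).r, (ch 1).exc⟩ : State K) = _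
    rw [hF']

/-! ## 4. Pure leaves over `K` -/

omit [Fact p.Prime] [CharP K p] in
/-- A pure leaf `x^a` (some `p ∤ aᵢ`) in the general form over `K`, root set `{0}`. [folklore] -/
theorem monomial_eq_generalForm (a : Fin 4 → ℕ) (ha : ∃ i, ¬ p ∣ a i) :
    (monomial (Finsupp.equivFunOnFinite.symm a) (1 : K)) =
      (∏ i : Fin 4, ∏ c ∈ ({0} : Finset K), (X i + C c) ^ (p * (if c = 0 then a i / p else 0)) : MvPolynomial (Fin 4) K) *
        ((∏ i : Fin 4, ∏ c ∈ ({0} : Finset K), (X i + C c : MvPolynomial (Fin 4) K) ^ (if c = 0 then a i % p else 0)) -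
          C (∏ i : Fin 4, ∏ c ∈ ({0} : Finset K), (c : K) ^ (if c = 0 then a i % p else 0))) := by
  have hγ : (∏ i : Fin 4, ∏ c ∈ ({0} : Finset K), (c : K) ^ (if c = 0 then a i % p else 0)) = 0 := by
    obtain ⟨i, hi⟩ := ha
    refine Finset.prod_eq_zero (Finset.mem_univ i) ?_
    rw [Finset.prod_singleton, if_pos rfl]
    exact zero_pow (fun h => hi (Nat.dvd_of_mod_eq_zero h))
  rw [hγ, generalForm_C_zero]
  have h1 : ∀ i : Fin 4, (∏ c ∈ ({0} : Finset K), (X i + C c : MvPolynomial (Fin 4) K) ^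
      (p * (if c = 0 then a i / p else 0) + (if c = 0 then a i % p else 0))) = X i ^ a i := fun i => by
    rw [Finset.prod_singleton, if_pos rfl, if_pos rfl, C_0, add_zero, Nat.div_add_mod]
  simp_rw [h1]
  rw [monomial_eq, C_1, one_mul, Finsupp.prod_fintype _ _ (fun i => pow_zero _)]
  rfl

/-- **EVERY PURE LEAF WINS THE PLAIN GLOBAL GAME OVER EVERY FIELD OF CHARACTERISTIC `p`.** [OURS · counted 0] [folklore] -/
theorem stateWins_monomial_charP (a : Fin 4 → ℕ) (ha : ∃ i, ¬ p ∣ a i) (r : Fin 4 →₀ ℕ) (exc : Finset (Fin 4)) :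
    StateWins p (⟨monomial (Finsupp.equivFunOnFinite.symm a) 1, r, exc⟩ : State K) := by
  rw [monomial_eq_generalForm p a ha]
  refine ((classWins p _ {0} (fun (i : Fin 4) (c : K) => if c = 0 then a i / p else 0)
    (fun (i : Fin 4) (c : K) => if c = 0 then a i % p else 0) le_rfl (fun i c hc => ?_) (fun i c hc => ?_) (fun i c => ?_)
    (fun i c hc c' hc' => ?_) (fun i c hc c' hc' => ?_) ?_ r exc)).1
  · rw [if_neg (fun h => hc (by rw [h]; exact Finset.mem_singleton_self 0))]
  · rw [if_neg (fun h => hc (by rw [h]; exact Finset.mem_singleton_self 0))]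
  · split_ifs
    · exact Nat.mod_lt _ (Fact.out : p.Prime).pos
    · exact (Fact.out : p.Prime).pos
  · by_cases hc0 : c = 0
    · rw [if_neg (fun h => hc' (h.trans hc0.symm))]
    · rw [if_neg hc0] at hc; exact absurd rfl hc
  · by_cases hc0 : c = 0
    · rw [if_neg (fun h => hc' (h.trans hc0.symm))]
    · rw [if_neg hc0] at hc; exact absurd rfl hc
  · obtain ⟨i, hi⟩ := ha
    exact ⟨i, 0, by rw [if_pos rfl]; exact fun h => hi (Nat.dvd_of_mod_eq_zero h)⟩

/-- **MODE 1h TERMINATES FROM EVERY PURE LEAF OVER EVERY FIELD OF CHARACTERISTIC `p`.** [OURS · counted 0] [folklore] -/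
theorem no_step1h_chain_monomial_charP (a : Fin 4 → ℕ) (ha : ∃ i, ¬ p ∣ a i) (r : Fin 4 →₀ ℕ) (exc : Finset (Fin 4)) :
    ¬ ∃ ch : ℕ → State K, ch 0 = (⟨monomial (Finsupp.equivFunOnFinite.symm a) 1, r, exc⟩ : State K) ∧
      ∀ t, Step1h p (ch t) (ch (t + 1)) := by
  rw [monomial_eq_generalForm p a ha]
  refine ((classWins p _ {0} (fun (i : Fin 4) (c : K) => if c = 0 then a i / p else 0)
    (fun (i : Fin 4) (c : K) => if c = 0 then a i % p else 0) le_rfl (fun i c hc => ?_) (fun i c hc => ?_) (fun i c => ?_)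
    (fun i c hc c' hc' => ?_) (fun i c hc c' hc' => ?_) ?_ r exc)).2
  · rw [if_neg (fun h => hc (by rw [h]; exact Finset.mem_singleton_self 0))]
  · rw [if_neg (fun h => hc (by rw [h]; exact Finset.mem_singleton_self 0))]
  · split_ifs
    · exact Nat.mod_lt _ (Fact.out : p.Prime).pos
    · exact (Fact.out : p.Prime).pos
  · by_cases hc0 : c = 0
    · rw [if_neg (fun h => hc' (h.trans hc0.symm))]
    · rw [if_neg hc0] at hc; exact absurd rfl hc
  · by_cases hc0 : c = 0
    · rw [if_neg (fun h => hc' (h.trans hc0.symm))]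
    · rw [if_neg hc0] at hc; exact absurd rfl hc
  · obtain ⟨i, hi⟩ := ha
    exact ⟨i, 0, by rw [if_pos rfl]; exact fun h => hi (Nat.dvd_of_mod_eq_zero h)⟩

end PureLeafK

end Summit.ResolutionOfSingularities.ResolutionOfSingularities.Theorems.PIDim4

end
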